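import Summits.QuantumFields.YangMills.Theorems.BalabanUVNodesN15CovariantTwoGridPullback
import Summits.QuantumFields.YangMills.Theorems.BalabanUVNodesN15CovariantAveragingTransportSizes
import HarnessLib

/-!
# N15 = NE2 — PROGRAMME (PC-E): THE SIZES OF THE COVARIANT TWO-GRID PULL-BACK `τ_{U′}` — rows∕columns of the King-block staircase transport minus one from the
# one-bond letters, the exact difference `τ_{T′} − P̂ = M_{(S−1)ᵀ}∘P̂`, and its block majorant `𝟙[y = y′]·((1+ρ)^{(d+1)(L^m−1)} − 1)` between the lane's unit-block
# norms of the two grids — the `O(L^m·η′·|A′|) = O(η|A′|)` letter of dag-n15-c's memo §2 (a) in the lane's currency (dag-n15-a g37)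

Cell `pub-ymgap`, seat `pub-ymgap-dag-n15-a` (generation g37; KNIT-BY-NAME, count-neutral; HUMAN RULING D-0062; chair R424 venue).  `bears_on: R4∕N15 · K3⁸
SpineGivenEndpointR13SepCoPHV (stmt-QuantumFields-27366)`; filed `--supports stmt-QuantumFields-27366 --as helper` — COUNT-NEUTRAL.  THEOREMS only ([folklore] matrix
bookkeeping over the objects of `…CovariantTwoGridPullback`), 0 `def`, 0 `sorry`, no analytic estimate beyond `(1+ρ)^N − 1` product algebra.  Imports BY NAME this seat's
`…CovariantTwoGridPullback` (`kingLineT kingOff kingBase kingLegStart kingStairT kingSec ctauV ctauS`, `kingOff_lt`, `ctauV_apply`∕`ctauS_apply`) and n15-c∕182a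
`…CovariantAveragingTransportSizes` (`rows∕cols_mprod_sub_one_le`; through it pub-balaban `T4AxialChain.pow_sub_one_mono`); dag-n15-a∕dag-n15-c `…VectorCarrier`
(`loc_fine_mmul_pull_le`, `mmulOp`), pub-balaban `T4EtaRateCoeffDefect` (`pull`, `diagK`), dag-n15-a `…VectorPieceEntries` (`kingPr`∕`kingPrV`), n15-c∕183 `blockOf_kingPr`.
Nothing in the tree is modified, no landed name re-declared.

WHY (director-ym RULING (PC-E) 2026-08-30 22:21Z, dag-n15-c `PCE-DESIGN-g31.md` §2 (a)).  With TRANSPORT = covariant ruled in, every LOCAL operator's two-grid defect is computed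
in the cube gauge pair, where «`τ_{U′^{w′}} = τ + O(L^r·η′·|A′|) = τ + O(η·|A′|)`» turns the (P-R) lane's flat-`τ` local rows into the covariant ones with an `O(η)` correction
(memo §2 (a), item (m4)).  THIS FILE supplies that correction's letter, design-independent: if every transporter the staircase reads is `ρ`-close to `1` in columns (rows),
the King-block staircase transport is `((1+ρ)^{(d+1)(R−1)} − 1)`-close to `1` in columns (rows) — at most `(d+1)(R−1)` factors — and `τ_{T′} − P̂` (exactly the
multiplier `(kingStairT T′ − 1)ᵀ` after King's flat pull-back `P̂`) has the diagonal block majorant `𝟙[y = y′]·((1+ρ)^{(d+1)(L^m−1)} − 1)` from the coarse unit-block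
norm to the fine one; with the cube-gauge letter `ρ = r_V·η′` of (3.35) this is `≤ e^{(d+1)L^m r_V η′} − 1 = O((d+1)·r_V·η)` (`L^m η′ = η`), the memo's `O(η|A′|)`.  The
hypotheses are stated on exactly the bond-points the staircase reads (`kingLegStart R x i + t·e_i`, `t < kingOff R x i`, slice `p.2`), so a per-cube consumer discharges
them from per-cube letters; the block-letter forms take any block-dependent letter `o(y)`.

RESULTS ([folklore] bookkeeping).
* §1 `rows∕cols_kingLineT_sub_one_le` (`≤ (1+ρ)^s − 1`), ★ `rows∕cols_kingStairT_sub_one_le` (`≤ (1+ρ)^{(d+1)(R−1)} − 1`, `R > 0`).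
* §2 `kingPr_kingLegStart_add_smul`∕`blockOf_kingLegStart_add_smul` (the staircase reads only its own King block ∕ unit block), ★ `ctauV_sub_pull_apply`∕`ctauS_sub_pull_apply`
  (the exact pointwise form of `τ_{T′} − P̂`), ★★ `hasMaj_ctauV_of_cols`∕`hasMaj_ctauV_sub_pull_of_cols` (block majorants
  `diagK o` from block letters `o(y)` of the columns of `S`, resp. `S − 1`), ★★ `hasMaj_ctauV_sub_pull` (uniform letter from per-bond column letters `ρ`:
  `diagK (fun _ => (1+ρ)^{(d+1)(L^m−1)} − 1)`), and the site editions `hasMaj_ctauS_sub_pull_of_cols`∕`hasMaj_ctauS_sub_pull`.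

HONEST FRAMING ∕ LIMITS.  Product∕row-sum algebra only; the identification `ρ = r_V η′` with the (3.35) letters and the resulting `O(η)` are (m4)'s, not asserted here;
MODEL carriers; nothing of [B7]∕[B9] asserted; NE2⁺ NOT PRINTED, NOT proved; N15 of record untouched (DISCHARGED AS CONSUMED, p687738); K3⁸ OPEN; counts of record
UNMOVED (typed 28∕28 · discharged 8∕27); one finite 𝕋⁴ at fixed ε per index — NOT infinite volume, NOT OS on ℝ⁴, NOT a mass gap, NOT Clay.  Restate-immune (no Theses import).
-/

noncomputable section

open scoped BigOperators Matrix
open Finset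

namespace Summit.QuantumFields.YangMills.BalabanUVNodes.N15.CovAvg

open Literature.MathematicalPhysics.QuantumFieldTheory.Balaban1983to89
open Literature.MathematicalPhysics.QuantumFieldTheory.Balaban1983to89.B5Prop11Plancherel (Tor fine unitVec)
open Literature.MathematicalPhysics.QuantumFieldTheory.Balaban1983to89.B11SectG (BlockNorm HasMaj)
open Literature.MathematicalPhysics.QuantumFieldTheory.Balaban1983to89.B6UnitTorusCarrier (unitTorusGeo)
open Literature.MathematicalPhysics.QuantumFieldTheory.Balaban1983to89.T4EtaRateCoeffDefect (pull pull_apply diagK)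
open Literature.MathematicalPhysics.QuantumFieldTheory.Balaban1983to89.T4AxialChain (pow_sub_one_mono)
open Literature.MathematicalPhysics.QuantumFieldTheory.King1986.Torus (blockOf)
open Summit.QuantumFields.YangMills.BalabanUVNodes.N15.VectorPiece (kingPr kingPrV kingPrV_eq kingPr_val)
open Summit.QuantumFields.YangMills.BalabanUVNodes.N15.MatrixSpecies (mmulOp mmulOp_apply liftBlk liftMap loc_fine_mmul_pull_le)

variable {d : ℕ}

/-! ## §1 Rows and columns of the staircase transport minus one -/

section Letters

variable (M : Fin (d + 1) → ℕ) [∀ μ, NeZero (M μ)] (N : ℕ) [NeZero N] (R : ℕ) {ι : Type} [Fintype ι] [DecidableEq ι]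

omit [∀ μ, NeZero (M μ)] [NeZero N] in
/-- Rows of `kingLineT − 1`: `≤ (1+ρ)^s − 1` when the `s` transporters read are `ρ`-close to `1` in rows. [folklore] -/
theorem rows_kingLineT_sub_one_le {T : Fin (d + 1) → Tor (fine N M) × Fin (d + 1) → Matrix ι ι ℝ} {ρ : ℝ} (hρ : 0 ≤ ρ) (μ ν : Fin (d + 1)) (x : Tor (fine N M))
    {s : ℕ} (hT : ∀ t < s, ∀ i, ∑ j, |(T μ (x + t • unitVec (fine N M) μ, ν) - 1) i j| ≤ ρ) (i : ι) :
    ∑ j, |(kingLineT M N T μ ν x s - 1) i j| ≤ (1 + ρ) ^ s - 1 := by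
  rw [kingLineT]
  exact rows_mprod_sub_one_le hρ hT i

omit [∀ μ, NeZero (M μ)] [NeZero N] in
/-- Columns of `kingLineT − 1`. [folklore] -/
theorem cols_kingLineT_sub_one_le {T : Fin (d + 1) → Tor (fine N M) × Fin (d + 1) → Matrix ι ι ℝ} {ρ : ℝ} (hρ : 0 ≤ ρ) (μ ν : Fin (d + 1)) (x : Tor (fine N M))
    {s : ℕ} (hT : ∀ t < s, ∀ j, ∑ i, |(T μ (x + t • unitVec (fine N M) μ, ν) - 1) i j| ≤ ρ) (j : ι) :
    ∑ i, |(kingLineT M N T μ ν x s - 1) i j| ≤ (1 + ρ) ^ s - 1 := by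
  rw [kingLineT]
  exact cols_mprod_sub_one_le hρ hT j

omit [∀ μ, NeZero (M μ)] [NeZero N] in
/-- ★ ROWS OF THE KING-BLOCK STAIRCASE TRANSPORT MINUS ONE: `Σ_j |(kingStairT R T p − 1)_{ij}| ≤ (1+ρ)^{(d+1)(R−1)} − 1` when every transporter THE STAIRCASE READS (leg `i′` from
`kingLegStart R p.1 i′`, `t < kingOff R p.1 i′` steps, slice `p.2`) is `ρ`-close to `1` in rows — at most `(d+1)(R−1)` factors. [cite: Balaban1985Averaging, (125)–(126) p.36 (shape)] -/
theorem rows_kingStairT_sub_one_le {T : Fin (d + 1) → Tor (fine N M) × Fin (d + 1) → Matrix ι ι ℝ} {ρ : ℝ} (hρ : 0 ≤ ρ) (hR : 0 < R) (p : Tor (fine N M) × Fin (d + 1))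
    (hT : ∀ (i' : Fin (d + 1)) (t : ℕ), t < kingOff M N R p.1 i' → ∀ i, ∑ j, |(T i' (kingLegStart M N R p.1 i' + t • unitVec (fine N M) i', p.2) - 1) i j| ≤ ρ) (i : ι) :
    ∑ j, |(kingStairT M N R T p - 1) i j| ≤ (1 + ρ) ^ ((d + 1) * (R - 1)) - 1 := by
  have hρ₁ : 0 ≤ (1 + ρ) ^ (R - 1) - 1 := by have := one_le_pow₀ (M₀ := ℝ) (a := 1 + ρ) (by linarith) (n := R - 1); linarith
  have hleg : ∀ t < d + 1, ∀ i, ∑ j, |((if h : t < d + 1 then kingLineT M N T ⟨t, h⟩ p.2 (kingLegStart M N R p.1 t) (kingOff M N R p.1 ⟨t, h⟩) else 1) - 1) i j| ≤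
      (1 + ρ) ^ (R - 1) - 1 := by
    intro t ht i
    rw [dif_pos ht]
    exact (rows_kingLineT_sub_one_le M N hρ _ _ _ (fun s hs i'' => hT ⟨t, ht⟩ s hs i'') i).trans
      (pow_sub_one_mono hρ (Nat.le_sub_one_of_lt (kingOff_lt M N R hR p.1 ⟨t, ht⟩)))
  rw [kingStairT]
  refine (rows_mprod_sub_one_le hρ₁ hleg i).trans (le_of_eq ?_)
  rw [add_sub_cancel, ← pow_mul, mul_comm]

omit [∀ μ, NeZero (M μ)] [NeZero N] in
/-- ★ COLUMNS OF THE KING-BLOCK STAIRCASE TRANSPORT MINUS ONE (transporters `ρ`-close to `1` in columns). [cite: Balaban1985Averaging, (125)–(126) p.36 (shape)] -/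
theorem cols_kingStairT_sub_one_le {T : Fin (d + 1) → Tor (fine N M) × Fin (d + 1) → Matrix ι ι ℝ} {ρ : ℝ} (hρ : 0 ≤ ρ) (hR : 0 < R) (p : Tor (fine N M) × Fin (d + 1))
    (hT : ∀ (i' : Fin (d + 1)) (t : ℕ), t < kingOff M N R p.1 i' → ∀ j, ∑ i, |(T i' (kingLegStart M N R p.1 i' + t • unitVec (fine N M) i', p.2) - 1) i j| ≤ ρ) (j : ι) :
    ∑ i, |(kingStairT M N R T p - 1) i j| ≤ (1 + ρ) ^ ((d + 1) * (R - 1)) - 1 := by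
  have hρ₁ : 0 ≤ (1 + ρ) ^ (R - 1) - 1 := by have := one_le_pow₀ (M₀ := ℝ) (a := 1 + ρ) (by linarith) (n := R - 1); linarith
  have hleg : ∀ t < d + 1, ∀ j, ∑ i, |((if h : t < d + 1 then kingLineT M N T ⟨t, h⟩ p.2 (kingLegStart M N R p.1 t) (kingOff M N R p.1 ⟨t, h⟩) else 1) - 1) i j| ≤
      (1 + ρ) ^ (R - 1) - 1 := by
    intro t ht j
    rw [dif_pos ht]
    exact (cols_kingLineT_sub_one_le M N hρ _ _ _ (fun s hs j'' => hT ⟨t, ht⟩ s hs j'') j).trans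
      (pow_sub_one_mono hρ (Nat.le_sub_one_of_lt (kingOff_lt M N R hR p.1 ⟨t, ht⟩)))
  rw [kingStairT]
  refine (cols_mprod_sub_one_le hρ₁ hleg j).trans (le_of_eq ?_)
  rw [add_sub_cancel, ← pow_mul, mul_comm]

end Letters

/-! ## §2 King's pair: `τ_{T′} − P̂` exactly, and its block majorants between the two grids' unit-block norms -/

section KingPair

variable (M : Fin (d + 1) → ℕ) [∀ μ, NeZero (M μ)] (L k m : ℕ) [NeZero L] {ι : Type} [Fintype ι] [DecidableEq ι]

/-- ★ THE STAIRCASE READS ONLY ITS OWN KING BLOCK: every bond-point read by `kingStairT (L^m) T′ (x′, ν)` — `kingLegStart x′ i + t·e_i`, `t < kingOff x′ i` — projects to `πx′`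
(so a per-cube ∕ per-block consumer discharges the letters of §1 from letters on the block of `x′`). [cite: King1986, p.664 (pairing convention)] -/
theorem kingPr_kingLegStart_add_smul (x' : Tor (fine (L ^ m * L ^ k) M)) (i : Fin (d + 1)) {t : ℕ} (ht : t < kingOff M (L ^ m * L ^ k) (L ^ m) x' i) :
    kingPr L k m M (kingLegStart M (L ^ m * L ^ k) (L ^ m) x' i + t • unitVec (fine (L ^ m * L ^ k) M) i) = kingPr L k m M x' := by
  have hLm : 0 < L ^ m := Nat.pos_of_ne_zero (NeZero.ne _)
  have ht' : t < (x' i).val % L ^ m := ht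
  have htR : t < L ^ m := lt_of_lt_of_le ht' (Nat.mod_lt _ hLm).le
  funext ν
  apply ZMod.val_injective
  rw [kingPr_val, kingPr_val]
  simp only [Pi.add_apply, Pi.smul_apply, unitVec, kingLegStart]
  by_cases hν : ν = i
  · subst hν
    rw [Pi.single_eq_same, if_neg (lt_irrefl _), nsmul_eq_mul, mul_one]
    have hb : (kingBase M (L ^ m * L ^ k) (L ^ m) x' ν).val = L ^ m * ((x' ν).val / L ^ m) := kingBase_val M (L ^ m * L ^ k) (L ^ m) x' ν
    have hdm := Nat.div_add_mod ((x' ν).val) (L ^ m)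
    have hv : (x' ν).val < fine (L ^ m * L ^ k) M ν := ZMod.val_lt _
    have htv : ((t : ℕ) : ZMod (fine (L ^ m * L ^ k) M ν)).val = t := by
      rw [ZMod.val_natCast, Nat.mod_eq_of_lt (by omega)]
    have hsum : (kingBase M (L ^ m * L ^ k) (L ^ m) x' ν).val + ((t : ℕ) : ZMod (fine (L ^ m * L ^ k) M ν)).val < fine (L ^ m * L ^ k) M ν := by
      rw [hb, htv]; omega
    rw [ZMod.val_add_of_lt hsum, hb, htv, Nat.mul_add_div hLm, Nat.div_eq_of_lt htR, add_zero]
  · rw [Pi.single_eq_of_ne hν, smul_zero, add_zero]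
    by_cases h : (ν : ℕ) < i
    · rw [if_pos h]
    · rw [if_neg h, kingBase_val, Nat.mul_div_cancel_left _ hLm]

/-- … hence stays in the unit block of `x′`: `B′(kingLegStart x′ i + t·e_i) = B′(x′)`. [cite: King1986, p.664 (pairing convention)] -/
theorem blockOf_kingLegStart_add_smul (x' : Tor (fine (L ^ m * L ^ k) M)) (i : Fin (d + 1)) {t : ℕ} (ht : t < kingOff M (L ^ m * L ^ k) (L ^ m) x' i) :
    blockOf (L ^ m * L ^ k) M (kingLegStart M (L ^ m * L ^ k) (L ^ m) x' i + t • unitVec (fine (L ^ m * L ^ k) M) i) = blockOf (L ^ m * L ^ k) M x' := by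
  rw [← blockOf_kingPr M L k m, kingPr_kingLegStart_add_smul M L k m x' i ht, blockOf_kingPr]

omit [∀ μ, NeZero (M μ)] [NeZero L] in
/-- ★ THE DIFFERENCE TO THE FLAT PULL-BACK, pointwise: `((τ_{T′} − P̂)f)((x′, ν), j) = Σ_i (kingStairT T′ (x′, ν) − 1)_{ij} f((πx′, ν), i)`. [folklore] -/
theorem ctauV_sub_pull_apply (T' : Fin (d + 1) → Tor (fine (L ^ m * L ^ k) M) × Fin (d + 1) → Matrix ι ι ℝ) (f : (Tor (fine (L ^ k) M) × Fin (d + 1)) × ι → ℝ)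
    (q : (Tor (fine (L ^ m * L ^ k) M) × Fin (d + 1)) × ι) :
    (ctauV M L k m T' - pull (liftMap (kingPrV L k m M) ι)) f q =
      ∑ i, (kingStairT M (L ^ m * L ^ k) (L ^ m) T' q.1 - 1) i q.2 * f ((kingPr L k m M q.1.1, q.1.2), i) := by
  rw [LinearMap.sub_apply, Pi.sub_apply, ctauV_apply, pull_apply]
  simp only [liftMap, kingPrV_eq, Matrix.sub_apply, Matrix.one_apply, sub_mul, sum_sub_distrib, ite_mul, one_mul, zero_mul, sum_ite_eq', mem_univ, if_true]

omit [∀ μ, NeZero (M μ)] [NeZero L] in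
/-- The same on site fields. [folklore] -/
theorem ctauS_sub_pull_apply (T' : Fin (d + 1) → Tor (fine (L ^ m * L ^ k) M) → Matrix ι ι ℝ) (f : Tor (fine (L ^ k) M) × ι → ℝ) (q : Tor (fine (L ^ m * L ^ k) M) × ι) :
    (ctauS M L k m T' - pull (liftMap (kingPr L k m M) ι)) f q =
      ∑ i, (kingStairT M (L ^ m * L ^ k) (L ^ m) (fun μ b => T' μ b.1) (q.1, 0) - 1) i q.2 * f (kingPr L k m M q.1, i) := by
  rw [LinearMap.sub_apply, Pi.sub_apply, ctauS_apply, pull_apply]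
  simp only [liftMap, Matrix.sub_apply, Matrix.one_apply, sub_mul, sum_sub_distrib, ite_mul, one_mul, zero_mul, sum_ite_eq', mem_univ, if_true]

/-- ★★ **THE COVARIANT PULL-BACK OF 1-FORMS IS A BLOCK CONTRACTION UP TO THE STAIRCASE's COLUMN LETTER**: block letters `o(y) ≥ 0` for the columns of `kingStairT T′ p′` on the fine
unit block `y` give `τ_{T′} ≤ 𝟙[y = y′]·o(y′)` from the coarse unit-block norm to the fine one. [folklore] -/
theorem hasMaj_ctauV_of_cols {T' : Fin (d + 1) → Tor (fine (L ^ m * L ^ k) M) × Fin (d + 1) → Matrix ι ι ℝ} {o : Tor M → ℝ} (ho : ∀ y, 0 ≤ o y)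
    (hc : ∀ (p' : Tor (fine (L ^ m * L ^ k) M) × Fin (d + 1)) (j : ι), ∑ i, |kingStairT M (L ^ m * L ^ k) (L ^ m) T' p' i j| ≤ o (blockOf (L ^ m * L ^ k) M p'.1)) :
    HasMaj (BlockNorm.ofBlocks (unitTorusGeo L k M) (liftBlk (fun b : Tor (fine (L ^ k) M) × Fin (d + 1) => blockOf (L ^ k) M b.1) ι))
      (BlockNorm.ofBlocks (unitTorusGeo L k M) (liftBlk (fun b : Tor (fine (L ^ m * L ^ k) M) × Fin (d + 1) => blockOf (L ^ m * L ^ k) M b.1) ι))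
      (ctauV M L k m T') (diagK o) := by
  have hlift : liftBlk ((fun b : Tor (fine (L ^ k) M) × Fin (d + 1) => blockOf (L ^ k) M b.1) ∘ kingPrV L k m M) ι =
      liftBlk (fun b : Tor (fine (L ^ m * L ^ k) M) × Fin (d + 1) => blockOf (L ^ m * L ^ k) M b.1) ι :=
    funext fun p => by simp only [liftBlk, Function.comp_apply, kingPrV_eq]; exact blockOf_kingPr M L k m p.1.1
  intro y' μ hμ y
  have hfun : ctauV M L k m T' μ = fun p => ∑ j, (fun p' : Tor (fine (L ^ m * L ^ k) M) × Fin (d + 1) => (kingStairT M (L ^ m * L ^ k) (L ^ m) T' p')ᵀ) p.1 p.2 j *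
      μ (kingPrV L k m M p.1, j) := funext fun p => by rw [ctauV_apply, kingPrV_eq]; rfl
  rw [hfun, ← hlift]
  exact loc_fine_mmul_pull_le (g := unitTorusGeo L k M) (c := fun p' : Tor (fine (L ^ m * L ^ k) M) × Fin (d + 1) => (kingStairT M (L ^ m * L ^ k) (L ^ m) T' p')ᵀ)
    (fun b : Tor (fine (L ^ k) M) × Fin (d + 1) => blockOf (L ^ k) M b.1) (kingPrV L k m M) ho
    (fun x' i => by simp only [Matrix.transpose_apply, kingPrV_eq, blockOf_kingPr]; exact hc x' i) hμ y

/-- ★★ **THE DIFFERENCE `τ_{T′} − P̂` HAS THE DIAGONAL BLOCK MAJORANT OF THE COLUMN LETTER OF `kingStairT T′ − 1`**: block letters `o(y)` for the columns of `kingStairT T′ p′ − 1` on the fine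
unit block `y` give `τ_{T′} − P̂ ≤ 𝟙[y = y′]·o(y′)`. [folklore] -/
theorem hasMaj_ctauV_sub_pull_of_cols {T' : Fin (d + 1) → Tor (fine (L ^ m * L ^ k) M) × Fin (d + 1) → Matrix ι ι ℝ} {o : Tor M → ℝ} (ho : ∀ y, 0 ≤ o y)
    (hc : ∀ (p' : Tor (fine (L ^ m * L ^ k) M) × Fin (d + 1)) (j : ι), ∑ i, |(kingStairT M (L ^ m * L ^ k) (L ^ m) T' p' - 1) i j| ≤ o (blockOf (L ^ m * L ^ k) M p'.1)) :
    HasMaj (BlockNorm.ofBlocks (unitTorusGeo L k M) (liftBlk (fun b : Tor (fine (L ^ k) M) × Fin (d + 1) => blockOf (L ^ k) M b.1) ι))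
      (BlockNorm.ofBlocks (unitTorusGeo L k M) (liftBlk (fun b : Tor (fine (L ^ m * L ^ k) M) × Fin (d + 1) => blockOf (L ^ m * L ^ k) M b.1) ι))
      (ctauV M L k m T' - pull (liftMap (kingPrV L k m M) ι)) (diagK o) := by
  have hlift : liftBlk ((fun b : Tor (fine (L ^ k) M) × Fin (d + 1) => blockOf (L ^ k) M b.1) ∘ kingPrV L k m M) ι =
      liftBlk (fun b : Tor (fine (L ^ m * L ^ k) M) × Fin (d + 1) => blockOf (L ^ m * L ^ k) M b.1) ι :=
    funext fun p => by simp only [liftBlk, Function.comp_apply, kingPrV_eq]; exact blockOf_kingPr M L k m p.1.1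
  intro y' μ hμ y
  have hfun : (ctauV M L k m T' - pull (liftMap (kingPrV L k m M) ι)) μ =
      fun p => ∑ j, (fun p' : Tor (fine (L ^ m * L ^ k) M) × Fin (d + 1) => (kingStairT M (L ^ m * L ^ k) (L ^ m) T' p' - 1)ᵀ) p.1 p.2 j * μ (kingPrV L k m M p.1, j) :=
    funext fun p => by rw [ctauV_sub_pull_apply, kingPrV_eq]; rfl
  rw [hfun, ← hlift]
  exact loc_fine_mmul_pull_le (g := unitTorusGeo L k M) (c := fun p' : Tor (fine (L ^ m * L ^ k) M) × Fin (d + 1) => (kingStairT M (L ^ m * L ^ k) (L ^ m) T' p' - 1)ᵀ)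
    (fun b : Tor (fine (L ^ k) M) × Fin (d + 1) => blockOf (L ^ k) M b.1) (kingPrV L k m M) ho
    (fun x' i => by simp only [Matrix.transpose_apply, kingPrV_eq, blockOf_kingPr]; exact hc x' i) hμ y

/-- ★★ **THE `O(η)` LETTER OF THE COVARIANT PULL-BACK (memo §2 (a), design-independent form)**: if every fine transporter is `ρ`-close to `1` in columns, then
`τ_{T′} − P̂ ≤ 𝟙[y = y′]·((1+ρ)^{(d+1)(L^m−1)} − 1)` from the coarse unit-block norm to the fine one (`(d+1)(L^m−1)` factors; with `ρ = r·η′` this is `O((d+1)·r·η)`).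
[cite: Balaban1985Averaging, (125)–(126) p.36 (shape)] -/
theorem hasMaj_ctauV_sub_pull {T' : Fin (d + 1) → Tor (fine (L ^ m * L ^ k) M) × Fin (d + 1) → Matrix ι ι ℝ} {ρ : ℝ} (hρ : 0 ≤ ρ)
    (hT : ∀ μ (q : Tor (fine (L ^ m * L ^ k) M) × Fin (d + 1)) (j : ι), ∑ i, |(T' μ q - 1) i j| ≤ ρ) :
    HasMaj (BlockNorm.ofBlocks (unitTorusGeo L k M) (liftBlk (fun b : Tor (fine (L ^ k) M) × Fin (d + 1) => blockOf (L ^ k) M b.1) ι))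
      (BlockNorm.ofBlocks (unitTorusGeo L k M) (liftBlk (fun b : Tor (fine (L ^ m * L ^ k) M) × Fin (d + 1) => blockOf (L ^ m * L ^ k) M b.1) ι))
      (ctauV M L k m T' - pull (liftMap (kingPrV L k m M) ι)) (diagK fun _ => (1 + ρ) ^ ((d + 1) * (L ^ m - 1)) - 1) := by
  have h0 : 0 ≤ (1 + ρ) ^ ((d + 1) * (L ^ m - 1)) - 1 := by
    have := one_le_pow₀ (M₀ := ℝ) (a := 1 + ρ) (by linarith) (n := (d + 1) * (L ^ m - 1)); linarith
  exact hasMaj_ctauV_sub_pull_of_cols M L k m (fun _ => h0) fun p' j =>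
    cols_kingStairT_sub_one_le M (L ^ m * L ^ k) (L ^ m) hρ (Nat.pos_of_ne_zero (NeZero.ne _)) p' (fun i' t _ j' => hT i' _ j') j

/-- ★ THE SITE EDITION of `hasMaj_ctauV_sub_pull_of_cols` (site transporters read on the slice `0`). [folklore] -/
theorem hasMaj_ctauS_sub_pull_of_cols {T' : Fin (d + 1) → Tor (fine (L ^ m * L ^ k) M) → Matrix ι ι ℝ} {o : Tor M → ℝ} (ho : ∀ y, 0 ≤ o y)
    (hc : ∀ (x' : Tor (fine (L ^ m * L ^ k) M)) (j : ι), ∑ i, |(kingStairT M (L ^ m * L ^ k) (L ^ m) (fun μ b => T' μ b.1) (x', 0) - 1) i j| ≤ o (blockOf (L ^ m * L ^ k) M x')) :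
    HasMaj (BlockNorm.ofBlocks (unitTorusGeo L k M) (liftBlk (blockOf (L ^ k) M) ι)) (BlockNorm.ofBlocks (unitTorusGeo L k M) (liftBlk (blockOf (L ^ m * L ^ k) M) ι))
      (ctauS M L k m T' - pull (liftMap (kingPr L k m M) ι)) (diagK o) := by
  have hlift : liftBlk (blockOf (L ^ k) M ∘ kingPr L k m M) ι = liftBlk (blockOf (L ^ m * L ^ k) M) ι := funext fun p => blockOf_kingPr M L k m p.1
  intro y' μ hμ y
  have hfun : (ctauS M L k m T' - pull (liftMap (kingPr L k m M) ι)) μ =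
      fun p => ∑ j, (fun x' : Tor (fine (L ^ m * L ^ k) M) => (kingStairT M (L ^ m * L ^ k) (L ^ m) (fun μ b => T' μ b.1) (x', 0) - 1)ᵀ) p.1 p.2 j * μ (kingPr L k m M p.1, j) :=
    funext fun p => by rw [ctauS_sub_pull_apply]; rfl
  rw [hfun, ← hlift]
  exact loc_fine_mmul_pull_le (g := unitTorusGeo L k M) (c := fun x' : Tor (fine (L ^ m * L ^ k) M) => (kingStairT M (L ^ m * L ^ k) (L ^ m) (fun μ b => T' μ b.1) (x', 0) - 1)ᵀ)
    (blockOf (L ^ k) M) (kingPr L k m M) ho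
    (fun x' i => by simp only [Matrix.transpose_apply, blockOf_kingPr]; exact hc x' i) hμ y

/-- ★ THE SITE EDITION of the `O(η)` letter. [cite: Balaban1985Averaging, (125)–(126) p.36 (shape)] -/
theorem hasMaj_ctauS_sub_pull {T' : Fin (d + 1) → Tor (fine (L ^ m * L ^ k) M) → Matrix ι ι ℝ} {ρ : ℝ} (hρ : 0 ≤ ρ)
    (hT : ∀ μ (x : Tor (fine (L ^ m * L ^ k) M)) (j : ι), ∑ i, |(T' μ x - 1) i j| ≤ ρ) :
    HasMaj (BlockNorm.ofBlocks (unitTorusGeo L k M) (liftBlk (blockOf (L ^ k) M) ι)) (BlockNorm.ofBlocks (unitTorusGeo L k M) (liftBlk (blockOf (L ^ m * L ^ k) M) ι))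
      (ctauS M L k m T' - pull (liftMap (kingPr L k m M) ι)) (diagK fun _ => (1 + ρ) ^ ((d + 1) * (L ^ m - 1)) - 1) := by
  have h0 : 0 ≤ (1 + ρ) ^ ((d + 1) * (L ^ m - 1)) - 1 := by
    have := one_le_pow₀ (M₀ := ℝ) (a := 1 + ρ) (by linarith) (n := (d + 1) * (L ^ m - 1)); linarith
  exact hasMaj_ctauS_sub_pull_of_cols M L k m (fun _ => h0) fun x' j =>
    cols_kingStairT_sub_one_le M (L ^ m * L ^ k) (L ^ m) hρ (Nat.pos_of_ne_zero (NeZero.ne _)) (x', 0) (fun i' t _ j' => hT i' _ j') j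

end KingPair

end Summit.QuantumFields.YangMills.BalabanUVNodes.N15.CovAvg

end
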